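import Summits.AtomisticToContinuum.FouriersLaw.Theses.HoelderEscapeProfile
import Summits.AtomisticToContinuum.FouriersLaw.Theorems.HoelderEscapeProfileCornerNoDipSplit
import Summits.AtomisticToContinuum.FouriersLaw.Theorems.HoelderEscapeProfileFibreCalculus
import Summits.AtomisticToContinuum.FouriersLaw.Theorems.CoercivePulsePulseCalculus
import Summits.AtomisticToContinuum.FouriersLaw.Theorems.CornerNoDip.Negative.FalseWithoutDynamics

/-!
# Abelian transfer for crux `CornerNoDip` (stmt-AtomisticToContinuum-16009, route `HoelderEscapeProfile`): a sublinear negative PULSE moment in time gives K2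

TIME-DOMAIN form of the line's one remaining dynamical input, in the arena of route `CoercivePulse` (pulse
`S(x,t) = Cov_μ(h_0, h_x∘φ_t)`, Helfand moment `M(t) = Σ_x x²S(x,t)`): if the NEGATIVE pulse moment
`M⁻(t) := Σ_x x²·max(−S(x,t),0)` grows sublinearly (`∀ ε > 0 ∃ B ∀ t > 0, M⁻(t) ≤ B + εt` — "the cold part of the
spreading energy pulse carries no diffusive second moment"; void when `S ≥ 0`, e.g. at the harmonic member), then the
Abel heating profile has vanishing `ν`-weighted negative second moment (the registered stub of line `heatprofile`) and
hence `CornerNoDip` holds (`cornerNoDip_of_negativePulseMomentSublinear`, glue: closes nothing). The landed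
`FibreCalculus` (p160893, clause 3: Abel integrability of `S(x,·)`) and `CoercivePulse.PulseCalculus` (clause 3:
`Σ_x(1+x²)|S(x,t)| < ∞` at every `t`) supply the guards; the core `abelNegMoment_of_timeDomain` is pure
measure-theoretic real analysis: if `S : ℤ → ℝ → ℝ` has `t ↦ e^{-νt}S(x,t)` integrable on
`(0,∞)` for every `x` and `ν > 0`, `x ↦ x²·S(x,t)⁻` summable for every `t > 0`, and the negative pulse moment is
SUBLINEAR, `∀ ε > 0 ∃ B ≥ 0 ∀ t > 0, Σ_x x²·S(x,t)⁻ ≤ B + εt`, then the Abel profile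
`Sb ν x = ν∫₀^∞e^{-νt}S(x,t)dt` has vanishing `ν`-weighted negative second moment: `ν·Σ_x x²·(Sb ν x)⁻ → 0`.
(Jensen for the negative part, finite sums under the integral, `∫₀^∞e^{-νt}(B + ct)dt ≤ B/ν + 4c/ν²`,
bounded partial sums of a non-negative family.) Helper file `--supports stmt-AtomisticToContinuum-16009` (lead c2, cycle 3).
-/

noncomputable section

open Filter Topology Set MeasureTheory Finset

namespace Summit.AtomisticToContinuum.FouriersLaw.Theorems.CornerNoDip.HeatProfile

/-- `t·e^{-νt} ≤ (2/ν)·e^{-(ν/2)t}` for every real `t` (`ν > 0`): from `1 + u ≤ e^u`. [folklore] -/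
theorem mul_exp_neg_mul_le {ν : ℝ} (hν : 0 < ν) (t : ℝ) :
    t * Real.exp (-(ν * t)) ≤ 2 / ν * Real.exp (-(ν / 2 * t)) := by
  have h1 : ν / 2 * t + 1 ≤ Real.exp (ν / 2 * t) := Real.add_one_le_exp _
  have h2 : t ≤ 2 / ν * Real.exp (ν / 2 * t) :=
    calc t = 2 / ν * (ν / 2 * t) := by field_simp
      _ ≤ 2 / ν * Real.exp (ν / 2 * t) := mul_le_mul_of_nonneg_left (by linarith) (by positivity)
  have h3 : Real.exp (-(ν / 2 * t)) = Real.exp (ν / 2 * t) * Real.exp (-(ν * t)) := by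
    rw [← Real.exp_add]; ring_nf
  rw [h3]
  calc t * Real.exp (-(ν * t)) ≤ 2 / ν * Real.exp (ν / 2 * t) * Real.exp (-(ν * t)) :=
        mul_le_mul_of_nonneg_right h2 (Real.exp_pos _).le
    _ = 2 / ν * (Real.exp (ν / 2 * t) * Real.exp (-(ν * t))) := by ring

/-- The Abel weight against an affine function: `t ↦ e^{-νt}(B + ct)` is integrable on `(0,∞)` and
`∫₀^∞ e^{-νt}(B + ct)dt ≤ B/ν + 4c/ν²` (`B, c ≥ 0`). [folklore] -/
theorem abel_affine_integral_le {ν c : ℝ} (B : ℝ) (hν : 0 < ν) (hc : 0 ≤ c) :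
    IntegrableOn (fun t : ℝ => Real.exp (-(ν * t)) * (B + c * t)) (Set.Ioi 0) ∧
      ∫ t in Set.Ioi (0:ℝ), Real.exp (-(ν * t)) * (B + c * t) ≤ B / ν + 4 * c / ν ^ 2 := by
  have hE : IntegrableOn (fun t : ℝ => Real.exp (-(ν * t))) (Set.Ioi 0) := by
    have h0 : IntegrableOn (fun t : ℝ => Real.exp (-ν * t)) (Set.Ioi 0) := exp_neg_integrableOn_Ioi 0 hν
    exact IntegrableOn.congr_fun h0 (fun t _ => by ring_nf) measurableSet_Ioi
  have hE2 : IntegrableOn (fun t : ℝ => Real.exp (-(ν / 2 * t))) (Set.Ioi 0) := by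
    have h0 : IntegrableOn (fun t : ℝ => Real.exp (-(ν / 2) * t)) (Set.Ioi 0) :=
      exp_neg_integrableOn_Ioi 0 (by positivity : 0 < ν / 2)
    exact IntegrableOn.congr_fun h0 (fun t _ => by ring_nf) measurableSet_Ioi
  -- the linear part is dominated by (2c/ν) e^{-(ν/2)t}
  have hmeas : AEStronglyMeasurable (fun t : ℝ => Real.exp (-(ν * t)) * (c * t))
      (volume.restrict (Set.Ioi 0)) :=
    (Continuous.aestronglyMeasurable (by fun_prop))
  have hL : IntegrableOn (fun t : ℝ => Real.exp (-(ν * t)) * (c * t)) (Set.Ioi 0) := by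
    refine Integrable.mono' ((hE2.const_mul (c * (2 / ν)))) hmeas ?_
    refine ae_restrict_of_forall_mem measurableSet_Ioi (fun t (ht : 0 < t) => ?_)
    rw [Real.norm_eq_abs, abs_of_nonneg (by positivity)]
    calc Real.exp (-(ν * t)) * (c * t) = c * (t * Real.exp (-(ν * t))) := by ring
      _ ≤ c * (2 / ν * Real.exp (-(ν / 2 * t))) :=
          mul_le_mul_of_nonneg_left (mul_exp_neg_mul_le hν t) hc
      _ = c * (2 / ν) * Real.exp (-(ν / 2 * t)) := by ring
  have hsplit : (fun t : ℝ => Real.exp (-(ν * t)) * (B + c * t)) =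
      fun t : ℝ => B * Real.exp (-(ν * t)) + Real.exp (-(ν * t)) * (c * t) := by
    funext t; ring
  refine ⟨?_, ?_⟩
  · rw [hsplit]; exact (hE.const_mul B).add hL
  · rw [hsplit, integral_add (hE.const_mul B) hL, integral_const_mul, CornerNoDip.Negative.integral_exp_neg_mul_Ioi_zero hν]
    have hLint : ∫ t in Set.Ioi (0:ℝ), Real.exp (-(ν * t)) * (c * t) ≤ 4 * c / ν ^ 2 := by
      calc ∫ t in Set.Ioi (0:ℝ), Real.exp (-(ν * t)) * (c * t)
          ≤ ∫ t in Set.Ioi (0:ℝ), c * (2 / ν) * Real.exp (-(ν / 2 * t)) := by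
            refine setIntegral_mono_on hL (hE2.const_mul _) measurableSet_Ioi (fun t ht => ?_)
            calc Real.exp (-(ν * t)) * (c * t) = c * (t * Real.exp (-(ν * t))) := by ring
              _ ≤ c * (2 / ν * Real.exp (-(ν / 2 * t))) :=
                  mul_le_mul_of_nonneg_left (mul_exp_neg_mul_le hν t) hc
              _ = c * (2 / ν) * Real.exp (-(ν / 2 * t)) := by ring
        _ = c * (2 / ν) * (1 / (ν / 2)) := by
            rw [integral_const_mul, CornerNoDip.Negative.integral_exp_neg_mul_Ioi_zero (by positivity : 0 < ν / 2)]
        _ = 4 * c / ν ^ 2 := by field_simp; ring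
    have e : B * (1 / ν) = B / ν := by ring
    rw [e]
    linarith

/-- Negative part of the Abel weight times a function: `max(−(e^{-νt}S), 0) = e^{-νt}·max(−S, 0)`. [folklore] -/
theorem negPart_exp_mul (ν t s : ℝ) :
    max (-(Real.exp (-(ν * t)) * s)) 0 = Real.exp (-(ν * t)) * max (-s) 0 := by
  rw [mul_max_of_nonneg _ _ (Real.exp_pos _).le, mul_neg, mul_zero]

/-- **Jensen for the negative part of an Abel mean**: if `t ↦ e^{-νt}S(t)` is integrable on `(0,∞)` then
`max(−ν∫₀^∞e^{-νt}S, 0) ≤ ν∫₀^∞e^{-νt}·max(−S,0)` (`ν ≥ 0`). [folklore] -/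
theorem negPart_abel_le {ν : ℝ} (hν : 0 ≤ ν) {S : ℝ → ℝ}
    (hS : IntegrableOn (fun t : ℝ => Real.exp (-(ν * t)) * S t) (Set.Ioi 0)) :
    max (-(ν * ∫ t in Set.Ioi (0:ℝ), Real.exp (-(ν * t)) * S t)) 0 ≤
      ν * ∫ t in Set.Ioi (0:ℝ), Real.exp (-(ν * t)) * max (-(S t)) 0 := by
  have hN : IntegrableOn (fun t : ℝ => Real.exp (-(ν * t)) * max (-(S t)) 0) (Set.Ioi 0) := by
    have h0 : IntegrableOn (fun t : ℝ => max (-(Real.exp (-(ν * t)) * S t)) 0) (Set.Ioi 0) := hS.neg_part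
    exact IntegrableOn.congr_fun h0 (fun t _ => negPart_exp_mul ν t (S t)) measurableSet_Ioi
  have h0 : 0 ≤ ∫ t in Set.Ioi (0:ℝ), Real.exp (-(ν * t)) * max (-(S t)) 0 :=
    setIntegral_nonneg measurableSet_Ioi fun t _ => mul_nonneg (Real.exp_pos _).le (le_max_right _ _)
  have h1 : -(∫ t in Set.Ioi (0:ℝ), Real.exp (-(ν * t)) * S t) ≤
      ∫ t in Set.Ioi (0:ℝ), Real.exp (-(ν * t)) * max (-(S t)) 0 := by
    rw [← integral_neg]
    refine setIntegral_mono_on hS.neg hN measurableSet_Ioi (fun t _ => ?_)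
    have : -(S t) ≤ max (-(S t)) 0 := le_max_left _ _
    calc -(Real.exp (-(ν * t)) * S t) = Real.exp (-(ν * t)) * (-(S t)) := by ring
      _ ≤ Real.exp (-(ν * t)) * max (-(S t)) 0 := mul_le_mul_of_nonneg_left this (Real.exp_pos _).le
  refine max_le ?_ (mul_nonneg hν h0)
  calc -(ν * ∫ t in Set.Ioi (0:ℝ), Real.exp (-(ν * t)) * S t)
      = ν * (-(∫ t in Set.Ioi (0:ℝ), Real.exp (-(ν * t)) * S t)) := by ring
    _ ≤ ν * ∫ t in Set.Ioi (0:ℝ), Real.exp (-(ν * t)) * max (-(S t)) 0 := mul_le_mul_of_nonneg_left h1 hν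

/-- **Abelian transfer.** Let `S : ℤ → ℝ → ℝ`, `Sb ν x = ν∫₀^∞e^{-νt}S(x,t)dt` (`hSb`), with `e^{-νt}S(x,·)`
integrable on `(0,∞)` for all `x`, `ν > 0` (`hInt`) and `x ↦ x²·S(x,t)⁻` summable for all `t > 0` (`hSum`). If the
negative pulse moment is sublinear — `∀ ε > 0 ∃ B ≥ 0 ∀ t > 0, Σ_x x²·max(−S(x,t),0) ≤ B + εt` (`hTD`) — then
`∀ ε > 0 ∃ ν₀ > 0 ∀ ν ∈ (0,ν₀], ν·Σ_x x²·max(−Sb ν x, 0) ≤ ε`. [folklore] -/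
theorem abelNegMoment_of_timeDomain (S : ℤ → ℝ → ℝ) (Sb : ℝ → ℤ → ℝ)
    (hSb : ∀ (ν : ℝ) (x : ℤ), Sb ν x = ν * ∫ t in Set.Ioi (0:ℝ), Real.exp (-(ν * t)) * S x t)
    (hInt : ∀ (x : ℤ) (ν : ℝ), 0 < ν → IntegrableOn (fun t : ℝ => Real.exp (-(ν * t)) * S x t) (Set.Ioi 0))
    (hSum : ∀ t : ℝ, 0 < t → Summable (fun x : ℤ => (x : ℝ) ^ 2 * max (-(S x t)) 0))
    (hTD : ∀ ε : ℝ, 0 < ε → ∃ B : ℝ, 0 ≤ B ∧ ∀ t : ℝ, 0 < t →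
      ∑' x : ℤ, (x : ℝ) ^ 2 * max (-(S x t)) 0 ≤ B + ε * t) :
    ∀ ε : ℝ, 0 < ε → ∃ ν₀ : ℝ, 0 < ν₀ ∧ ∀ ν : ℝ, 0 < ν → ν ≤ ν₀ →
      ν * (∑' x : ℤ, (x : ℝ) ^ 2 * max (-(Sb ν x)) 0) ≤ ε := by
  intro ε hε
  obtain ⟨B, hB0, hB⟩ := hTD (ε / 8) (by positivity)
  refine ⟨ε / (2 * B + 1), by positivity, fun ν hν hνle => ?_⟩
  have hνB : ν * B ≤ ε / 2 := by
    rw [le_div_iff₀ (by positivity)] at hνle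
    nlinarith [hνle, hν, hB0]
  -- the negative parts
  set P : ℤ → ℝ → ℝ := fun x t => max (-(S x t)) 0 with hP
  have hP0 : ∀ x t, 0 ≤ P x t := fun x t => le_max_right _ _
  -- integrability of the Abel-weighted negative parts
  have hIntP : ∀ x : ℤ, IntegrableOn (fun t : ℝ => Real.exp (-(ν * t)) * P x t) (Set.Ioi 0) := by
    intro x
    have h0 : IntegrableOn (fun t : ℝ => max (-(Real.exp (-(ν * t)) * S x t)) 0) (Set.Ioi 0) :=
      (hInt x ν hν).neg_part
    exact IntegrableOn.congr_fun h0 (fun t _ => negPart_exp_mul ν t (S x t)) measurableSet_Ioi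
  obtain ⟨hAffInt, hAffLe⟩ := abel_affine_integral_le B hν (by positivity : (0:ℝ) ≤ ε / 8)
  -- integrability of the Abel-weighted, x²-weighted negative parts
  have hIntPx : ∀ x : ℤ, IntegrableOn
      (fun t : ℝ => Real.exp (-(ν * t)) * ((x : ℝ) ^ 2 * P x t)) (Set.Ioi 0) := by
    intro x
    have h0 : IntegrableOn (fun t : ℝ => (x : ℝ) ^ 2 * (Real.exp (-(ν * t)) * P x t)) (Set.Ioi 0) :=
      (hIntP x).const_mul ((x : ℝ) ^ 2)
    exact IntegrableOn.congr_fun h0 (fun t _ => by ring) measurableSet_Ioi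
  -- pointwise Jensen: x²·(Sb ν x)⁻ ≤ ν ∫ e^{-νt} x² P x t
  have hterm : ∀ x : ℤ, (x : ℝ) ^ 2 * max (-(Sb ν x)) 0 ≤
      ν * ∫ t in Set.Ioi (0:ℝ), Real.exp (-(ν * t)) * ((x : ℝ) ^ 2 * P x t) := by
    intro x
    have hJ := negPart_abel_le hν.le (hInt x ν hν)
    have e1 : (fun t : ℝ => Real.exp (-(ν * t)) * ((x : ℝ) ^ 2 * P x t)) =
        fun t : ℝ => (x : ℝ) ^ 2 * (Real.exp (-(ν * t)) * max (-(S x t)) 0) := by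
      funext t; simp only [hP]; ring
    rw [hSb ν x, e1, integral_const_mul]
    calc (x : ℝ) ^ 2 * max (-(ν * ∫ t in Set.Ioi (0:ℝ), Real.exp (-(ν * t)) * S x t)) 0
        ≤ (x : ℝ) ^ 2 * (ν * ∫ t in Set.Ioi (0:ℝ), Real.exp (-(ν * t)) * max (-(S x t)) 0) :=
          mul_le_mul_of_nonneg_left hJ (sq_nonneg _)
      _ = ν * ((x : ℝ) ^ 2 * ∫ t in Set.Ioi (0:ℝ), Real.exp (-(ν * t)) * max (-(S x t)) 0) := by ring
  -- bounded partial sums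
  have hfin : ∀ s : Finset ℤ, ∑ x ∈ s, ν * ((x : ℝ) ^ 2 * max (-(Sb ν x)) 0) ≤ ε := by
    intro s
    have h1 : ∑ x ∈ s, (x : ℝ) ^ 2 * max (-(Sb ν x)) 0 ≤
        ν * ∫ t in Set.Ioi (0:ℝ), Real.exp (-(ν * t)) * ∑ x ∈ s, (x : ℝ) ^ 2 * P x t := by
      calc ∑ x ∈ s, (x : ℝ) ^ 2 * max (-(Sb ν x)) 0
          ≤ ∑ x ∈ s, ν * ∫ t in Set.Ioi (0:ℝ), Real.exp (-(ν * t)) * ((x : ℝ) ^ 2 * P x t) :=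
            Finset.sum_le_sum fun x _ => hterm x
        _ = ν * ∑ x ∈ s, ∫ t in Set.Ioi (0:ℝ), Real.exp (-(ν * t)) * ((x : ℝ) ^ 2 * P x t) := by
            rw [Finset.mul_sum]
        _ = ν * ∫ t in Set.Ioi (0:ℝ), ∑ x ∈ s, Real.exp (-(ν * t)) * ((x : ℝ) ^ 2 * P x t) := by
            rw [integral_finsetSum s (fun x _ => hIntPx x)]
        _ = ν * ∫ t in Set.Ioi (0:ℝ), Real.exp (-(ν * t)) * ∑ x ∈ s, (x : ℝ) ^ 2 * P x t := by
            congr 1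
            refine setIntegral_congr_fun measurableSet_Ioi (fun t _ => ?_)
            rw [Finset.mul_sum]
    have hIs : IntegrableOn (fun t : ℝ => Real.exp (-(ν * t)) * ∑ x ∈ s, (x : ℝ) ^ 2 * P x t)
        (Set.Ioi 0) := by
      have e2 : (fun t : ℝ => Real.exp (-(ν * t)) * ∑ x ∈ s, (x : ℝ) ^ 2 * P x t) =
          fun t : ℝ => ∑ x ∈ s, Real.exp (-(ν * t)) * ((x : ℝ) ^ 2 * P x t) := by
        funext t; rw [Finset.mul_sum]
      rw [e2]
      exact integrable_finsetSum s (fun x _ => hIntPx x)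
    have h2 : ∫ t in Set.Ioi (0:ℝ), Real.exp (-(ν * t)) * ∑ x ∈ s, (x : ℝ) ^ 2 * P x t ≤
        ∫ t in Set.Ioi (0:ℝ), Real.exp (-(ν * t)) * (B + ε / 8 * t) := by
      refine setIntegral_mono_on hIs hAffInt measurableSet_Ioi (fun t ht => ?_)
      have hle : ∑ x ∈ s, (x : ℝ) ^ 2 * P x t ≤ B + ε / 8 * t :=
        ((hSum t ht).sum_le_tsum s (fun x _ => mul_nonneg (sq_nonneg _) (hP0 x t))).trans (hB t ht)
      exact mul_le_mul_of_nonneg_left hle (Real.exp_pos _).le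
    calc ∑ x ∈ s, ν * ((x : ℝ) ^ 2 * max (-(Sb ν x)) 0)
        = ν * ∑ x ∈ s, (x : ℝ) ^ 2 * max (-(Sb ν x)) 0 := by rw [Finset.mul_sum]
      _ ≤ ν * (ν * ∫ t in Set.Ioi (0:ℝ), Real.exp (-(ν * t)) * ∑ x ∈ s, (x : ℝ) ^ 2 * P x t) :=
          mul_le_mul_of_nonneg_left h1 hν.le
      _ ≤ ν * (ν * (B / ν + 4 * (ε / 8) / ν ^ 2)) :=
          mul_le_mul_of_nonneg_left (mul_le_mul_of_nonneg_left (h2.trans hAffLe) hν.le) hν.le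
      _ = ν * B + ε / 2 := by field_simp; ring
      _ ≤ ε := by linarith
  have hnn : 0 ≤ fun x : ℤ => ν * ((x : ℝ) ^ 2 * max (-(Sb ν x)) 0) := fun x => by
    simp only [Pi.zero_apply]; positivity
  calc ν * ∑' x : ℤ, (x : ℝ) ^ 2 * max (-(Sb ν x)) 0
      = ∑' x : ℤ, ν * ((x : ℝ) ^ 2 * max (-(Sb ν x)) 0) := tsum_mul_left.symm
    _ ≤ ε := Real.tsum_le_of_sum_le hnn hfin

open Literature.MathematicalPhysics.KineticTheory.HeatConduction in
/-- **GLUE (time domain): a sublinear negative pulse moment gives `CornerNoDip`.** In the crux frame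
(`ω₂, lam, β > 0`, `T > 0`, `μ` a shift- and momentum-reversal-invariant DLR state of `pinnedChain ω₂ lam β γ`, `D` a
`μ`-preserving shift-covariant `InfiniteChainDynamics`, `h` the split-bond site energy and `S x t = Cov_μ(h_0, h_x∘φ_t)`
bound by their defining equations): if for every `ε > 0` there is `B ≥ 0` with
`Σ_x x²·max(−S(x,t),0) ≤ B + εt` for all `t > 0`, then `CornerNoDip`. Via `abelNegMoment_of_timeDomain` (guards
from the landed `FibreCalculus` clause 3 and `CoercivePulse.PulseCalculus` clause 3) and the landed split glue
`cornerNoDip_of_negativeHeatingMomentVanishes` (p166700). Glue only: closes nothing. [folklore] -/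
theorem cornerNoDip_of_negativePulseMomentSublinear :
    (∀ ω₂ lam β γ : ℝ, 0 < ω₂ → 0 < lam → 0 < β → ∀ T : ℝ, 0 < T →
      ∀ μ : Measure ChainConfig, (pinnedChain ω₂ lam β γ).IsChainGibbsMeasure T μ → IsShiftInvariant μ →
      μ.map (fun σ : ChainConfig => fun x : ℤ => ((σ x).1, -(σ x).2)) = μ →
      ∀ D : InfiniteChainDynamics (pinnedChain ω₂ lam β γ), D.PreservesMeasure μ →
      (∀ t : ℝ, ∀ᵐ σ ∂μ, D.flow t (shift σ) = shift (D.flow t σ)) →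
      ∀ h : ChainConfig → ℤ → ℝ, h = (fun (σ : ChainConfig) (x : ℤ) =>
      (σ x).2 ^ 2 / 2 + (pinnedChain ω₂ lam β γ).U (σ x).1 +
      ((pinnedChain ω₂ lam β γ).V ((σ (x + 1)).1 - (σ x).1) +
      (pinnedChain ω₂ lam β γ).V ((σ x).1 - (σ (x - 1)).1)) / 2) →
      ∀ S : ℤ → ℝ → ℝ, S = (fun (x : ℤ) (t : ℝ) =>
      ∫ σ, (h σ 0 - ∫ σ', h σ' 0 ∂μ) * (h (D.flow t σ) x - ∫ σ', h σ' 0 ∂μ) ∂μ) →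
      ∀ ε : ℝ, 0 < ε → ∃ B : ℝ, 0 ≤ B ∧ ∀ t : ℝ, 0 < t →
      ∑' x : ℤ, (x : ℝ) ^ 2 * max (-(S x t)) 0 ≤ B + ε * t) →
    Summit.AtomisticToContinuum.FouriersLaw.Theses.HoelderEscapeProfile.CornerNoDip := by
  intro hTD
  apply cornerNoDip_of_negativeHeatingMomentVanishes
  intro ω₂ lam β γ hω hl hβ T hT μ hGibbs hShiftI hRev D hPres hCov h hh S hS Sb hSb
  -- Abel integrability of `S(x,·)`: clause (3) of the landed `FibreCalculus`
  obtain ⟨-, -, hIntS, -⟩ :=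
    Summit.AtomisticToContinuum.FouriersLaw.Theorems.FibreCalculusSketch.fibreCalculus_proof ω₂ lam β γ
      hω hl hβ T hT μ hGibbs hShiftI hRev D hPres hCov h hh S hS Sb hSb _ rfl _ rfl _ rfl _ rfl
  -- fixed-time weighted summability of the pulse: clause (3) of the landed `CoercivePulse.PulseCalculus`
  obtain ⟨-, -, hSumS, -⟩ :=
    Summit.AtomisticToContinuum.FouriersLaw.Theorems.PulseCalculus.CanonicalReduction.pulseCalculus_proof
      ω₂ lam β γ hω hl hβ T hT μ hGibbs hShiftI hRev D hPres hCov h hh S hS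
  exact abelNegMoment_of_timeDomain S Sb (fun ν x => by rw [hSb]) hIntS
    (fun t _ => summable_sq_mul_negPart (hSumS t))
    (hTD ω₂ lam β γ hω hl hβ T hT μ hGibbs hShiftI hRev D hPres hCov h hh S hS)

end Summit.AtomisticToContinuum.FouriersLaw.Theorems.CornerNoDip.HeatProfile

end
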